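import Mathlib
import Summits.NavierStokesRegularity.NavierStokesRegularity.Theorems.FilamentSkeletonRssSkeletonJ1RLiaDerivKernelTools

/-!
# Crux `SkeletonJ1R` (stmt-NavierStokesRegularity-23610) · line `streamline_kantorovich_R` · toward stub F2-d (`LiaDefectDerivBL`, v7), brick for B2′:
# THE POINTWISE PARTNER MISMATCH OF THE DERIVATIVE KERNEL IN THE INNER ZONE: `≤ ‖P‖ (8θ/r³ + 157δ/r⁴)`

Lead `ns-fsr-lead-23610` g2, `--supports stmt-NavierStokesRegularity-23610 --as helper`.  MODEL rung, NEGATIVE side of the ladder: estimates for a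
HYPOTHETICAL filament-type blow-up skeleton; nothing here is a claim about Navier–Stokes regularity; the stub and the crux stay OPEN.

`norm_derivKernel_mismatch_le` — the derivative-kernel analogue of the inner-zone pointwise bounds of `…SkeletonJ1RMismatchTools` (P1 of the F2-B chain):
if the partner point `x σ` is within `δ ≤ r/5` of its datum-line point `L σ`, `r = ‖y − L σ‖ > 0`, the tilt is `‖x′σ − t‖ ≤ θ` (`‖x′σ‖ ≤ 1`, `‖t‖ = 1`),
then for every direction `P` and core constant `q > 0`
`‖G(y − x σ, x′σ, P) − G(y − L σ, t, P)‖ ≤ ‖P‖ · (8θ/r³ + 157δ/r⁴)`,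
`G(w,a,v) = (−3⟪w,v⟫K₅(w))•a×w + K₃(w)•a×v` — tilt channel `…KernelTools.norm_derivKernel_sub_left_le` with floor `(4r/5)²`, displacement channel
`…norm_derivKernel_sub_right_le` with `Mw = 6r/5`, `m = (4r/5)²`.  Integrating this over the inner zone with the F2-B envelopes `δ(σ)`, `θ(σ)` is P1′.
-/

set_option linter.dupNamespace false -- `NavierStokesRegularity.NavierStokesRegularity` path/namespace repetition is the tree convention

noncomputable section

namespace Summit.NavierStokesRegularity.NavierStokesRegularity.Theorems.SkeletonJ1RFrame

open Set Function Filter Real Topology MeasureTheory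
open Literature.Analysis.FluidPDE
open scoped InnerProductSpace BigOperators

/-- `(c²)^(−(k/2)) = (c^k)⁻¹` for `c ≥ 0` (cf. `Literature.Geometry.Riemannian.sq_rpow_natCast_div_two` for the positive exponent). [folklore] -/
theorem sq_rpow_neg_half_eq_inv_pow {c : ℝ} (hc : 0 ≤ c) (k : ℕ) : (c ^ 2) ^ (-((k : ℝ) / 2)) = (c ^ k)⁻¹ := by
  rw [Real.rpow_neg (by positivity), show c ^ 2 = c ^ (2:ℝ) by norm_cast, ← Real.rpow_mul hc,
    show (2:ℝ) * ((k : ℝ) / 2) = (k : ℝ) by ring, Real.rpow_natCast]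

/-- **POINTWISE PARTNER MISMATCH OF THE DERIVATIVE KERNEL, INNER ZONE.** [folklore] -/
theorem norm_derivKernel_mismatch_le {q r δ θ : ℝ} (hq : 0 < q) (hr : 0 < r) (hδ : 0 ≤ δ) (hδr : δ ≤ r / 5)
    {y xs Ls a t P : EuclideanSpace ℝ (Fin 3)} (ht : ‖t‖ = 1) (hrdef : ‖y - Ls‖ = r) (hdisp : ‖xs - Ls‖ ≤ δ) (htilt : ‖a - t‖ ≤ θ) :
    ‖((-3 * ⟪y - xs, P⟫_ℝ * ((‖y - xs‖ ^ 2 + q) ^ (5 / 2 : ℝ))⁻¹) • cross a (y - xs) + ((‖y - xs‖ ^ 2 + q) ^ (3 / 2 : ℝ))⁻¹ • cross a P) -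
      ((-3 * ⟪y - Ls, P⟫_ℝ * ((‖y - Ls‖ ^ 2 + q) ^ (5 / 2 : ℝ))⁻¹) • cross t (y - Ls) + ((‖y - Ls‖ ^ 2 + q) ^ (3 / 2 : ℝ))⁻¹ • cross t P)‖ ≤
      ‖P‖ * (8 * θ / r ^ 3 + 157 * δ / r ^ 4) := by
  have hθ : 0 ≤ θ := (norm_nonneg _).trans htilt
  set w₁ := y - xs with hw₁
  set w₂ := y - Ls with hw₂
  have hΔ : ‖w₁ - w₂‖ ≤ δ := by
    rw [hw₁, hw₂, show y - xs - (y - Ls) = -(xs - Ls) by abel, norm_neg]; exact hdisp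
  have hw₂n : ‖w₂‖ = r := hrdef
  -- ceilings and floors
  have hMw₁ : ‖w₁‖ ≤ 6 * r / 5 := by
    have : ‖w₁‖ ≤ ‖w₂‖ + ‖w₁ - w₂‖ := by
      calc ‖w₁‖ = ‖w₂ + (w₁ - w₂)‖ := by congr 1; abel
        _ ≤ ‖w₂‖ + ‖w₁ - w₂‖ := norm_add_le _ _
    linarith
  have hMw₂ : ‖w₂‖ ≤ 6 * r / 5 := by rw [hw₂n]; linarith
  have hlow₁ : 4 * r / 5 ≤ ‖w₁‖ := by
    have : ‖w₂‖ ≤ ‖w₁‖ + ‖w₁ - w₂‖ := by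
      calc ‖w₂‖ = ‖w₁ - (w₁ - w₂)‖ := by congr 1; abel
        _ ≤ ‖w₁‖ + ‖w₁ - w₂‖ := norm_sub_le _ _
    linarith
  set m : ℝ := (4 * r / 5) ^ 2 with hm
  have hm0 : 0 < m := by positivity
  have hc0 : (0:ℝ) ≤ 4 * r / 5 := by positivity
  have hm₁ : m ≤ ‖w₁‖ ^ 2 + q := by
    have : m ≤ ‖w₁‖ ^ 2 := pow_le_pow_left₀ hc0 hlow₁ 2
    linarith
  have hm₂ : m ≤ ‖w₂‖ ^ 2 + q := by
    have h1 : m ≤ ‖w₂‖ ^ 2 := by rw [hw₂n]; exact pow_le_pow_left₀ hc0 (by linarith) 2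
    linarith
  -- the powers of the floor
  have hm32 : m ^ (-(3 / 2 : ℝ)) = ((4 * r / 5) ^ 3)⁻¹ := by
    rw [hm, show (-(3 / 2 : ℝ)) = -(((3:ℕ) : ℝ) / 2) by norm_num]; exact sq_rpow_neg_half_eq_inv_pow hc0 3
  have hm52 : m ^ (-(5 / 2 : ℝ)) = ((4 * r / 5) ^ 5)⁻¹ := by
    rw [hm, show (-(5 / 2 : ℝ)) = -(((5:ℕ) : ℝ) / 2) by norm_num]; exact sq_rpow_neg_half_eq_inv_pow hc0 5
  have hm72 : m ^ (-(7 / 2 : ℝ)) = ((4 * r / 5) ^ 7)⁻¹ := by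
    rw [hm, show (-(7 / 2 : ℝ)) = -(((7:ℕ) : ℝ) / 2) by norm_num]; exact sq_rpow_neg_half_eq_inv_pow hc0 7
  -- tilt channel at w₁
  have htiltC := norm_derivKernel_sub_left_le hq a t w₁ P
  have hk3 : ((‖w₁‖ ^ 2 + q) ^ (3 / 2 : ℝ))⁻¹ ≤ m ^ (-(3 / 2 : ℝ)) := inv_rpow_normSq_le (by norm_num) hm0 hm₁
  have hT : ‖((-3 * ⟪w₁, P⟫_ℝ * ((‖w₁‖ ^ 2 + q) ^ (5 / 2 : ℝ))⁻¹) • cross a w₁ + ((‖w₁‖ ^ 2 + q) ^ (3 / 2 : ℝ))⁻¹ • cross a P) -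
      ((-3 * ⟪w₁, P⟫_ℝ * ((‖w₁‖ ^ 2 + q) ^ (5 / 2 : ℝ))⁻¹) • cross t w₁ + ((‖w₁‖ ^ 2 + q) ^ (3 / 2 : ℝ))⁻¹ • cross t P)‖ ≤
      ‖P‖ * (8 * θ / r ^ 3) := by
    refine htiltC.trans ?_
    calc 4 * ‖a - t‖ * ‖P‖ * ((‖w₁‖ ^ 2 + q) ^ (3 / 2 : ℝ))⁻¹ ≤ 4 * θ * ‖P‖ * m ^ (-(3 / 2 : ℝ)) := by gcongr
      _ = ‖P‖ * (4 * θ * ((4 * r / 5) ^ 3)⁻¹) := by rw [hm32]; ring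
      _ ≤ ‖P‖ * (8 * θ / r ^ 3) := by
          refine mul_le_mul_of_nonneg_left ?_ (norm_nonneg _)
          rw [div_eq_mul_inv (8 * θ)]
          have hr3 : 0 < r ^ 3 := by positivity
          have : ((4 * r / 5) ^ 3)⁻¹ = (125 / 64) * (r ^ 3)⁻¹ := by field_simp; ring
          rw [this]; nlinarith [inv_pos.2 hr3]
  -- displacement channel with a = t
  have hD := norm_derivKernel_sub_right_le hq hm0 t P hMw₁ hMw₂ hm₁ hm₂
  rw [ht, one_mul, hm52, hm72] at hD
  have hcoef : 9 * (6 * r / 5) * ((4 * r / 5) ^ 5)⁻¹ + 15 * (6 * r / 5) ^ 3 * ((4 * r / 5) ^ 7)⁻¹ = (320625 / 2048) / r ^ 4 := by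
    field_simp; ring
  have hD' : ‖((-3 * ⟪w₁, P⟫_ℝ * ((‖w₁‖ ^ 2 + q) ^ (5 / 2 : ℝ))⁻¹) • cross t w₁ + ((‖w₁‖ ^ 2 + q) ^ (3 / 2 : ℝ))⁻¹ • cross t P) -
      ((-3 * ⟪w₂, P⟫_ℝ * ((‖w₂‖ ^ 2 + q) ^ (5 / 2 : ℝ))⁻¹) • cross t w₂ + ((‖w₂‖ ^ 2 + q) ^ (3 / 2 : ℝ))⁻¹ • cross t P)‖ ≤
      ‖P‖ * (157 * δ / r ^ 4) := by
    refine hD.trans ?_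
    rw [hcoef]
    have hr4 : 0 < r ^ 4 := by positivity
    calc ‖P‖ * ‖w₁ - w₂‖ * (320625 / 2048 / r ^ 4) ≤ ‖P‖ * δ * (320625 / 2048 / r ^ 4) := by gcongr
      _ ≤ ‖P‖ * (157 * δ / r ^ 4) := by
          rw [mul_assoc]
          refine mul_le_mul_of_nonneg_left ?_ (norm_nonneg _)
          rw [mul_div_assoc', div_le_div_iff_of_pos_right hr4]
          nlinarith
  -- assemble
  calc _ ≤ ‖((-3 * ⟪w₁, P⟫_ℝ * ((‖w₁‖ ^ 2 + q) ^ (5 / 2 : ℝ))⁻¹) • cross a w₁ + ((‖w₁‖ ^ 2 + q) ^ (3 / 2 : ℝ))⁻¹ • cross a P) -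
        ((-3 * ⟪w₁, P⟫_ℝ * ((‖w₁‖ ^ 2 + q) ^ (5 / 2 : ℝ))⁻¹) • cross t w₁ + ((‖w₁‖ ^ 2 + q) ^ (3 / 2 : ℝ))⁻¹ • cross t P)‖ +
      ‖((-3 * ⟪w₁, P⟫_ℝ * ((‖w₁‖ ^ 2 + q) ^ (5 / 2 : ℝ))⁻¹) • cross t w₁ + ((‖w₁‖ ^ 2 + q) ^ (3 / 2 : ℝ))⁻¹ • cross t P) -
        ((-3 * ⟪w₂, P⟫_ℝ * ((‖w₂‖ ^ 2 + q) ^ (5 / 2 : ℝ))⁻¹) • cross t w₂ + ((‖w₂‖ ^ 2 + q) ^ (3 / 2 : ℝ))⁻¹ • cross t P)‖ :=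
        norm_sub_le_norm_sub_add_norm_sub _ _ _
    _ ≤ ‖P‖ * (8 * θ / r ^ 3) + ‖P‖ * (157 * δ / r ^ 4) := add_le_add hT hD'
    _ = ‖P‖ * (8 * θ / r ^ 3 + 157 * δ / r ^ 4) := by ring

end Summit.NavierStokesRegularity.NavierStokesRegularity.Theorems.SkeletonJ1RFrame

end
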